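import Literature.MathematicalPhysics.QuantumFieldTheory.ConformalBootstrap3D.PointKernel

/-!
# Point-certificate kernel evaluator: rule (O1) by the chord bound

`PointKernel.PCert.boxExcluded_of_kernel` asks rule (O1) — positivity of the functional on the unit
operator, `0 < φ[F^{s}_-[1]]` for `s ∈ [s_lo, s_hi]` — through the σ-CORNER number
`termCornerBound w z z̄ 0 0 0 s_lo s_hi`.  For an LP point functional the unit-operator value is
small against its gross mass (K34 certificate: `+2.8·10⁻³` against `Σ_k |w_k|(v_k^s + u_k^s) ≈ 6`),
and the corner loss, first order in `s_hi − s_lo = 10⁻³`, defeats it (`−1.8·10⁻²`), while the chord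
minorant of `PointFunctionalChord` (second order) does not (`+2.77·10⁻³`).  This file

* restates the table theorem with the (O1) obligation supplied directly
  (`boxExcluded_of_pointTable_twistI`, the tree theorem `boxExcluded_of_pointTable_twist` verbatim
  otherwise);
* adds the kernel check `PCert.o1OKC t` — the four vertex numbers of the chord minorant of the unit
  term on `s ∈ [s_lo, s_hi]`, `E ∈ [0, 2ρ_t]` (`j = 0`, `𝒫₀ ≡ 1`), evaluated with the chord tables of
  `PointKernel` — and its soundness `PCert.o1C_hyp`;
* assembles `PCert.boxExcluded_of_kernelC`, the kernel certificate theorem with (O1) in chord form.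
-/

namespace Literature.MathematicalPhysics.QuantumFieldTheory.ConformalBootstrap3D

open Literature.Analysis.ValidatedNumerics (rsum rall vget vtab vget_vtab vget_of_length_le rsum_eq_sum
  rall_eq_true_iff of_rall)
open Literature.Analysis.ValidatedNumerics.NumericsMP
open Real Finset Set

/-! ### The table theorem with the identity obligation supplied directly

`boxExcluded_of_pointTable_twist` asks rule (O1) as the CORNER number
`0 < termCornerBound w z z̄ 0 0 0 slo shi`; for a functional whose unit-operator value is small
compared with its gross mass the σ-corner loss (first order in `shi − slo`) defeats it, while the chord
bound (second order) does not.  The variant below takes the (O1) obligation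
`0 < φ[F^{s}_-[1]]` on `Q` itself; everything else is the tree theorem verbatim. -/

/-- **The point-functional certificate as a finite table, twist-gap domain, identity obligation
direct.**  As `boxExcluded_of_pointTable_twist` with `hI` replaced by (O1) on `Q` itself.
[cite: HogervorstRychkov2013, §3 eq. (3.6)] -/
theorem boxExcluded_of_pointTable_twistI {N : ℕ} {w z zb : Fin N → ℝ}
    (hz : ∀ k, z k ∈ Ioo (0 : ℝ) 1) (hzb : ∀ k, zb k ∈ Ioo (0 : ℝ) 1) (hord : ∀ k, zb k ≤ z k)
    (apex : Fin N) (hapex : 0 ≤ w apex) (qd qr : Fin N → ℝ) (hqd : ∀ k, 0 < qd k ∧ qd k ≤ 1)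
    (hqr : ∀ k, 0 < qr k ∧ qr k ≤ 1)
    (hdomd : ∀ k, z k * zb k ≤ qd k ^ 2 * (z apex * zb apex) ∧ z k ≤ qd k * z apex)
    (hdomr : ∀ k, (1 - z k) * (1 - zb k) ≤ qr k ^ 2 * (z apex * zb apex) ∧
      1 - zb k ≤ qr k * z apex)
    {Q : Set (ℝ × ℝ)} {slo shi εlo E₀ ET τ : ℝ}
    (hQ : ∀ p ∈ Q, (slo ≤ p.1 ∧ p.1 ≤ shi) ∧ (εlo ≤ p.2 ∧ p.2 < E₀))
    (hε3 : εlo ≤ 3) (L : ℕ) (hL : E₀ ≤ (L : ℝ) + 1) (hτ1 : τ ≤ 1) (hτ0 : τ ≤ E₀)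
    (hr : ∀ k, 1 / 2 ≤ ((1 - z k) * (1 - zb k)) ^ (shi - slo) ∧ 1 / 2 ≤ (z k * zb k) ^ (shi - slo))
    -- (O1), on `Q` itself
    (hI : ∀ p ∈ Q, 0 < pointFunctional w z zb (crossF p.1 (-1) (fun _ _ => (1 : ℝ))))
    -- head rows
    (t : ℕ → ℕ → ℝ) (K : ℕ → ℕ) (nF : ℕ → ℕ → ℕ) (hc : ℕ → ℕ → Bool)
    (ht0 : t 0 0 = εlo ∧ t 0 (K 0) = E₀)
    (htℓ : ∀ ℓ, Even ℓ → ℓ ≠ 0 → ℓ < L → t ℓ 0 = (ℓ : ℝ) + 1 ∧ t ℓ (K ℓ) = E₀)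
    (hlow : ∀ ℓ k, k < K ℓ → (ℓ : ℝ) + 1 ≤ t ℓ k)
    (hnF : ∀ ℓ k, k < K ℓ → E₀ ≤ t ℓ k + ((nF ℓ k : ℝ) + 1))
    (hρ : ∀ ℓ k, k < K ℓ → hc ℓ k = true → ∀ i, 1 / 2 ≤ (z i * zb i) ^ ((t ℓ (k + 1) - t ℓ k) / 2) ∧
      1 / 2 ≤ ((1 - z i) * (1 - zb i)) ^ ((t ℓ (k + 1) - t ℓ k) / 2))
    (hhead : ∀ ℓ, (ℓ = 0 ∨ (Even ℓ ∧ ℓ < L)) → ∀ k < K ℓ,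
      0 ≤ headNumber w z zb ℓ (t ℓ k) (t ℓ (k + 1)) slo shi (nF ℓ k) (hc ℓ k))
    -- (M) box rows
    (e : ℕ → ℕ → ℝ) (M : ℕ → ℕ) (bc : ℕ → ℕ → Bool)
    (he : ∀ j : ℕ, (j : ℝ) + τ < ET → e j 0 ≤ max E₀ ((j : ℝ) + τ) ∧ ET ≤ e j (M j))
    (hρM : ∀ j m, m < M j → bc j m = true → ∀ k, 1 / 2 ≤ (z k * zb k) ^ ((e j (m + 1) - e j m) / 2) ∧
      1 / 2 ≤ ((1 - z k) * (1 - zb k)) ^ ((e j (m + 1) - e j m) / 2))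
    (hbox : ∀ j : ℕ, (j : ℝ) + τ < ET → ∀ m < M j,
      0 ≤ boxNumber w z zb j (e j m) (e j (m + 1)) slo shi (bc j m))
    -- (T)
    (hB : ∑ k ∈ univ.erase apex, |w k| * ((1 - z k) * (1 - zb k)) ^ slo * qd k ^ ET
          + ∑ k, |w k| * (z k * zb k) ^ slo * qr k ^ ET ≤
          w apex * ((1 - z apex) * (1 - zb apex)) ^ shi) :
    BoxExcluded Q := by
  have hQ1 : ∀ p ∈ Q, slo ≤ p.1 ∧ p.1 ≤ shi := fun p hp => (hQ p hp).1
  have hM := ruleM_of_boxTable_twist w z zb hz hzb τ hQ1 hr e M bc he hρM hbox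
  -- every cell of every row
  have hcell : ∀ ℓ, (ℓ = 0 ∨ (Even ℓ ∧ ℓ < L)) → ∀ k < K ℓ, ∀ p ∈ Q,
      ∀ Δ ∈ Ico (t ℓ k) (t ℓ (k + 1)), BlockPositive (pointFunctional w z zb) p.1 Δ ℓ :=
    fun ℓ hℓ k hk => cell_of_headNumber_twist w z zb hz hzb hord apex hapex qd qr hqd hqr hdomd hdomr
      hQ1 hτ1 hM hB hr (hlow ℓ k hk) (nF ℓ k) (hnF ℓ k hk) (hc ℓ k) (hρ ℓ k hk) (hhead ℓ hℓ k hk)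
  exact SingleCorrelatorObligations.boxExcluded (Δstar := E₀) hz hzb
    { identity_pos := hI
      epsilon_nonneg := epsilon_nonneg_of_cells (t 0) (K 0)
        (fun p hp => ⟨ht0.1 ▸ (hQ p hp).2.1, ht0.2 ▸ (hQ p hp).2.2⟩) (hcell 0 (Or.inl rfl))
      scalar_nonneg := scalar_nonneg_of_cells (t 0) (K 0) (ht0.1 ▸ hε3) ht0.2 (hcell 0 (Or.inl rfl))
      spinning_nonneg := spinning_nonneg_of_cells L hL t K
        (fun ℓ hev hℓ hℓL => (htℓ ℓ hev hℓ hℓL).1.le) (fun ℓ hev hℓ hℓL => (htℓ ℓ hev hℓ hℓL).2)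
        (fun ℓ hev hℓ hℓL => hcell ℓ (Or.inr ⟨hev, hℓL⟩))
      tail_nonneg := fun p hp ℓ _ Δ hbd hΔ0 =>
        tail_nonneg_pointFunctional_of_termwise_and_apex_twist w z zb hz hzb hord apex hapex qd qr hqd
          hqr hdomd hdomr hQ1 hτ1 hτ0 hM hB p hp ℓ Δ hbd hΔ0 }

namespace PointKernel

/-! ### Rule (O1) by the chord bound -/

namespace PCert

variable (c : PCert)

/-- rule (O1) by the chord minorant: the four vertex numbers of the unit-operator term
(`j = 0`, `E ∈ [0, 2ρ_t]`, `s ∈ [slo, shi]`) are positive. [folklore] -/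
def o1OKC (t : ℕ) : Bool :=
  let ones : List MI := vtab c.N fun _ => MI.ofInt c.S 1
  let LT0 : List ℚ := (c.legTabs 0).map fun l => vget l 0
  let LTt0 : List ℚ := (c.legTabsT 0).map fun l => vget l 0
  c.nccOK && c.stepOKC t &&
  (decide (0 < dot2 LT0 ((c.iuTab (c.duListC false false c.nccTab t ones) 0 0).getD 0 []) LTt0
      ((c.ivTab (c.dvListC false false c.nccTab t ones) 0 0).getD 0 [])) &&
   decide (0 < dot2 LT0 ((c.iuTab (c.duListC true false c.nccTab t ones) 0 0).getD 0 []) LTt0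
      ((c.ivTab (c.dvListC true false c.nccTab t ones) 0 0).getD 0 [])) &&
   decide (0 < dot2 LT0 ((c.iuTab (c.duListC false true c.nccTab t ones) 0 0).getD 0 []) LTt0
      ((c.ivTab (c.dvListC false true c.nccTab t ones) 0 0).getD 0 [])) &&
   decide (0 < dot2 LT0 ((c.iuTab (c.duListC true true c.nccTab t ones) 0 0).getD 0 []) LTt0
      ((c.ivTab (c.dvListC true true c.nccTab t ones) 0 0).getD 0 [])))

variable {c}

/-- nodes lie in the open unit square (real form). [folklore] -/
theorem zR_mem (hc : c.checkNodes = true) : ∀ k : Fin c.N, c.zR k ∈ Ioo (0 : ℝ) 1 := by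
  intro k
  have hn := checkNode_of_checkNodes hc k.2
  exact ⟨by simpa [zR] using (show ((0:ℚ):ℝ) < ((c.z k : ℚ) : ℝ) by exact_mod_cast z_pos hn),
    by simpa [zR] using (show ((c.z k : ℚ) : ℝ) < ((1:ℚ):ℝ) by exact_mod_cast z_lt_one hn)⟩

/-- nodes lie in the open unit square (real form, `z̄`). [folklore] -/
theorem zbR_mem (hc : c.checkNodes = true) : ∀ k : Fin c.N, c.zbR k ∈ Ioo (0 : ℝ) 1 := by
  intro k
  have hn := checkNode_of_checkNodes hc k.2
  exact ⟨by simpa [zbR] using (show ((0:ℚ):ℝ) < ((c.zb k : ℚ) : ℝ) by exact_mod_cast zb_pos hn),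
    by simpa [zbR] using (show ((c.zb k : ℚ) : ℝ) < ((1:ℚ):ℝ) by exact_mod_cast zb_lt_one hn)⟩

/-- **Rule (O1) from the chord check**: `0 < φ[F^{s}_-[1]]` for every `s ∈ [slo, shi]`. [folklore] -/
theorem o1C_hyp (hc : c.checkNodes = true) (hside : c.sideOK = true) (t : ℕ) (h : c.o1OKC t = true)
    {s : ℝ} (hs : s ∈ Icc ((c.slo : ℚ) : ℝ) ((c.shi : ℚ) : ℝ)) :
    0 < pointFunctional c.wR c.zR c.zbR (crossF s (-1) (fun _ _ => (1 : ℝ))) := by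
  simp only [o1OKC, Bool.and_eq_true, decide_eq_true_eq] at h
  obtain ⟨⟨hn, hst⟩, ⟨⟨h00, h10⟩, h01⟩, h11⟩ := h
  have hS := S_pos hc
  have hSR : (0 : ℝ) < c.S := by exact_mod_cast hS
  have hone : ∀ (x : ℚ), 0 < x → ∀ k < c.N, MI.mem c.S (((x : ℚ) : ℝ) ^ (((0 : ℚ) : ℚ) : ℝ))
      (miAt (vtab c.N fun _ => MI.ofInt c.S 1) k) := by
    intro x hx k hk
    simp only [miAt, getD_vtab _ _ _ hk, Rat.cast_zero, Real.rpow_zero]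
    simpa using MI.mem_ofInt c.S 1
  have hXA : ∀ k < c.N, MI.mem c.S (((c.u k : ℚ) : ℝ) ^ (((0 : ℚ) : ℚ) : ℝ))
      (miAt (vtab c.N fun _ => MI.ofInt c.S 1) k) :=
    fun k hk => hone _ (u_pos (checkNode_of_checkNodes hc hk)) k hk
  have hYA : ∀ k < c.N, MI.mem c.S (((c.v k : ℚ) : ℝ) ^ (((0 : ℚ) : ℚ) : ℝ))
      (miAt (vtab c.N fun _ => MI.ofInt c.S 1) k) :=
    fun k hk => hone _ (v_pos (checkNode_of_checkNodes hc hk)) k hk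
  -- the four vertex numbers
  have key : ∀ θ η : Bool,
      0 < dot2 ((c.legTabs 0).map fun l => vget l 0)
        ((c.iuTab (c.duListC θ η c.nccTab t (vtab c.N fun _ => MI.ofInt c.S 1)) 0 0).getD 0 [])
        ((c.legTabsT 0).map fun l => vget l 0)
        ((c.ivTab (c.dvListC θ η c.nccTab t (vtab c.N fun _ => MI.ofInt c.S 1)) 0 0).getD 0 []) →
      0 < termChordBound c.wR c.zR c.zbR 0 ((c.slo : ℚ) : ℝ) ((c.shi : ℚ) : ℝ)
        ((((2 * (0 : ℚ) : ℚ)) : ℝ) + ((0 : ℕ) : ℝ))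
        ((((2 * ((0 : ℚ) + atomExp c.rho t) : ℚ)) : ℝ) + ((0 : ℕ) : ℝ)) (bR θ) (bR η) := by
    intro θ η hd
    have hle := dot2C_le hc hn θ η (ℓ := 0) (n := 0) (j := 0) (m' := 0) (by decide) (by norm_num)
      le_rfl (0 : ℚ) t hst _ _ hXA hYA 0 (by norm_num) (J := 0) le_rfl
    have hdR : (0 : ℝ) < (dot2 ((c.legTabs 0).map fun l => vget l 0)
        ((c.iuTab (c.duListC θ η c.nccTab t (vtab c.N fun _ => MI.ofInt c.S 1)) 0 0).getD 0 [])
        ((c.legTabsT 0).map fun l => vget l 0)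
        ((c.ivTab (c.dvListC θ η c.nccTab t (vtab c.N fun _ => MI.ofInt c.S 1)) 0 0).getD 0 []) : ℝ) := by
      exact_mod_cast hd
    by_contra hcon
    push Not at hcon
    nlinarith [hcon, hSR, hle, hdR]
  have v00 := key false false h00
  have v10 := key true false h10
  have v01 := key false true h01
  have v11 := key true true h11
  have hmin : 0 < termChordMin c.wR c.zR c.zbR 0 ((c.slo : ℚ) : ℝ) ((c.shi : ℚ) : ℝ)
      ((((2 * (0 : ℚ) : ℚ)) : ℝ) + ((0 : ℕ) : ℝ))
      ((((2 * ((0 : ℚ) + atomExp c.rho t) : ℚ)) : ℝ) + ((0 : ℕ) : ℝ)) := by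
    rw [termChordMin_eq_bR]
    exact lt_min (lt_min v00 v10) (lt_min v01 v11)
  -- the half conditions of the step
  have hρ : ∀ i : Fin c.N, 1 / 2 ≤ (c.zR i * c.zbR i) ^
        ((((((2 * ((0 : ℚ) + atomExp c.rho t) : ℚ)) : ℝ) + ((0 : ℕ) : ℝ)) -
          ((((2 * (0 : ℚ) : ℚ)) : ℝ) + ((0 : ℕ) : ℝ))) / 2) ∧
      1 / 2 ≤ ((1 - c.zR i) * (1 - c.zbR i)) ^
        ((((((2 * ((0 : ℚ) + atomExp c.rho t) : ℚ)) : ℝ) + ((0 : ℕ) : ℝ)) -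
          ((((2 * (0 : ℚ) : ℚ)) : ℝ) + ((0 : ℕ) : ℝ))) / 2) := by
    intro i
    have hst' := of_rall hst i.isLt
    simp only [Bool.and_eq_true, decide_eq_true_eq] at hst'
    obtain ⟨⟨_, hU⟩, hV⟩ := hst'
    have e : ((((((2 * ((0 : ℚ) + atomExp c.rho t) : ℚ)) : ℝ) + ((0 : ℕ) : ℝ)) -
          ((((2 * (0 : ℚ) : ℚ)) : ℝ) + ((0 : ℕ) : ℝ))) / 2) = ((atomExp c.rho t : ℚ) : ℝ) := by
      push_cast; ring
    have hu : c.zR i * c.zbR i = ((c.u i : ℚ) : ℝ) := by simp [zR, zbR, PCert.u]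
    have hv : (1 - c.zR i) * (1 - c.zbR i) = ((c.v i : ℚ) : ℝ) := by simp [zR, zbR, PCert.v]
    rw [e, hu, hv]
    exact ⟨half_le_of_checkHalf hU, half_le_of_checkHalf hV⟩
  have h0 : (0 : ℚ) ≤ atomExp c.rho t := by unfold atomExp; positivity
  have h0R : (0 : ℝ) ≤ ((atomExp c.rho t : ℚ) : ℝ) := by exact_mod_cast h0
  have hE : (0 : ℝ) ∈ Icc ((((2 * (0 : ℚ) : ℚ)) : ℝ) + ((0 : ℕ) : ℝ))
      ((((2 * ((0 : ℚ) + atomExp c.rho t) : ℚ)) : ℝ) + ((0 : ℕ) : ℝ)) := by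
    constructor
    · push_cast; norm_num
    · push_cast; linarith
  have := termChordMin_le c.wR c.zR c.zbR (zR_mem hc) (zbR_mem hc) 0 (side_hyp hside) hρ hs hE
  rw [zMono_zero_zero] at this
  exact hmin.trans_le this

end PCert

namespace PCert

variable {c : PCert}

/-- **The kernel certificate theorem, (O1) in chord form.** A point certificate whose node / (S) / (O1, chord form) /
(T) / meta checks evaluate to `true`, whose head cells (`ℓ < L`, corner or chord) deliver their
`CellFact` and whose (M) boxes (`j < J`) have nonnegative numbers — the two families of facts the
block checkers `hBlockOK`, `mBlockOK` establish by `decide` (`hBlockOK_sound`, `mBlockOK_sound`) —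
excludes its box. [cite: HogervorstRychkov2013, §3 eq. (3.6)] -/
theorem boxExcluded_of_kernelC (hc : c.checkNodes = true) (hside : c.sideOK = true)
    (tI : ℕ) (ho1 : c.o1OKC tI = true)
    (qd qr : List ℚ) (ET : ℕ) (hT : c.tOK qd qr ET = true)
    (εlo E0 τ : ℚ) (L J : ℕ) (hpar : paramOK εlo E0 τ L ET J = true)
    (hsegs : List HSeg) (hmetaH : hMetaOK c.rho hsegs εlo E0 L = true)
    (mrows : List MRow) (hmetaM : c.mMetaOK mrows E0 τ ET J = true)
    (hcells : ∀ i < hsegs.length, ∀ x ∈ segCells c.rho (segAt hsegs i), c.CellFact (segAt hsegs i).ell x)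
    (hboxes : ∀ j < J, ∀ m < (rowAt mrows j).steps.length,
      0 ≤ termCornerBound c.wR c.zR c.zbR j (c.eM mrows j m) (c.eM mrows j (m + 1))
        ((c.slo : ℚ) : ℝ) ((c.shi : ℚ) : ℝ)) :
    BoxExcluded (QBox c.slo c.shi εlo E0) := by
  simp only [paramOK, Bool.and_eq_true, decide_eq_true_eq] at hpar
  obtain ⟨⟨⟨⟨⟨hε3, hL⟩, hτ1⟩, hτ0⟩, hJ⟩, hL0⟩ := hpar
  obtain ⟨hqd, hqr, hdomd, hdomr, hB⟩ := t_hyps hc qd qr ET hT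
  obtain ⟨ht0, htℓ, hlow, hnF, hcell⟩ := head_hyps c.rho hsegs εlo E0 L hmetaH
  -- the facts of cell `k` of row `ℓ`
  have hF : ∀ ℓ k, k < KH c.rho hsegs ℓ → c.CellFact ℓ (cellAt c.rho hsegs ℓ k) := by
    intro ℓ k hk
    obtain ⟨-, -, i, hi, hell, hmem⟩ := hcell ℓ k hk
    have := hcells i hi _ hmem
    rwa [hell] at this
  have hhead : ∀ ℓ, (ℓ = 0 ∨ (Even ℓ ∧ ℓ < L)) → ∀ k < KH c.rho hsegs ℓ,
      0 ≤ headNumber c.wR c.zR c.zbR ℓ (tH c.rho hsegs ℓ k) (tH c.rho hsegs ℓ (k + 1)) ((c.slo : ℚ) : ℝ)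
        ((c.shi : ℚ) : ℝ) (nFH c.rho hsegs ℓ k) (bH c.rho hsegs ℓ k) := by
    intro ℓ _ k hk
    obtain ⟨e1, e2, -⟩ := hcell ℓ k hk
    rw [e1, e2, nFH, bH]
    exact (hF ℓ k hk).1
  have hρ : ∀ ℓ k, k < KH c.rho hsegs ℓ → bH c.rho hsegs ℓ k = true → ∀ i : Fin c.N,
      1 / 2 ≤ (c.zR i * c.zbR i) ^ ((tH c.rho hsegs ℓ (k + 1) - tH c.rho hsegs ℓ k) / 2) ∧
      1 / 2 ≤ ((1 - c.zR i) * (1 - c.zbR i)) ^ ((tH c.rho hsegs ℓ (k + 1) - tH c.rho hsegs ℓ k) / 2) := by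
    intro ℓ k hk hb i
    obtain ⟨e1, e2, -⟩ := hcell ℓ k hk
    rw [e1, e2]
    exact (hF ℓ k hk).2 hb i
  have hJR : ((ET : ℕ) : ℝ) ≤ (J : ℝ) + ((τ : ℚ) : ℝ) := by
    have : (((ET : ℚ)) : ℝ) ≤ (((J : ℚ) + τ : ℚ) : ℝ) := by exact_mod_cast hJ
    push_cast at this; exact this
  obtain ⟨he, hρM, hbox⟩ := ruleM_hyps mrows E0 τ ET J hJR hmetaM hboxes
  refine boxExcluded_of_pointTable_twistI (w := c.wR) (z := c.zR) (zb := c.zbR)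
    (slo := ((c.slo : ℚ) : ℝ)) (shi := ((c.shi : ℚ) : ℝ)) (εlo := ((εlo : ℚ) : ℝ)) (E₀ := ((E0 : ℚ) : ℝ))
    (ET := ((ET : ℕ) : ℝ)) (τ := ((τ : ℚ) : ℝ))
    (zR_mem hc) (zbR_mem hc) ?_ ⟨c.apex, apex_lt hc⟩ ?_ (c.qR qd) (c.qR qr) hqd hqr hdomd hdomr
    (fun p hp => hp) (by exact_mod_cast hε3) L (by exact_mod_cast hL) (by exact_mod_cast hτ1)
    (by exact_mod_cast hτ0) (side_hyp hside) (fun p hp => o1C_hyp hc hside tI ho1 hp.1)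
    (tH c.rho hsegs) (KH c.rho hsegs) (nFH c.rho hsegs) (bH c.rho hsegs) ht0 htℓ hlow hnF
    hρ hhead (c.eM mrows) (fun j => (rowAt mrows j).steps.length)
    (fun _ _ => false) he hρM hbox hB
  · intro k
    have hn := checkNode_of_checkNodes hc k.2
    simpa [zR, zbR] using (show ((c.zb k : ℚ) : ℝ) ≤ ((c.z k : ℚ) : ℝ) by exact_mod_cast zb_le_z hn)
  · simpa [wR] using (show ((0 : ℚ) : ℝ) ≤ ((c.w c.apex : ℚ) : ℝ) by exact_mod_cast w_apex_nonneg hc)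

end PCert

end PointKernel

end Literature.MathematicalPhysics.QuantumFieldTheory.ConformalBootstrap3D
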